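import Summits.ResolutionOfSingularities.ResolutionOfSingularities.Theorems.EquisingularLiftEquisingularLiftNatPrefixReachClosedLN
import Summits.ResolutionOfSingularities.ResolutionOfSingularities.Theorems.EquisingularLiftEquisingularLiftNatTowerNestDefs
import HarnessLib

/-!
# [OURS · L1 W4.5(b) · EL♮(3) · A⁵ = NEST(1), WIDTH TABLE D3, brick D3-4] S-T56″ — THE A⁵ PREFIX REACH DELIVERS A CLOSED `T` ON A LOCALLY
# NOETHERIAN `F` (`isClosed_and_isLocallyNoetherian_of_prefixReachBQuintPrime`; tower half `…_of_reachTowerBQuintPrime`, step `towerNestB₅_closedLN`)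

res-L1-w45b-stub-2 g15 (desk RULING R39 2026-08-28T17:31:05Z, WIDTH TABLE D3 «NEST», hand D3-4 «S-T56″ `IsClosed T ∧ IsLocallyNoetherian F` over prefix⁵
(motive extension of ✓ `…NatPrefixReachClosedLN`)»; pre-cleared by type + kernel by res-L1-w45b-crit-3 (l.≈82501) and res-L1-w45b-crit-2 (l.≈82505)).
= ✓ p651608 `…NatPrefixReachClosedLN` (S-T56′, A⁗) with ONE more generating step in the tower motive: res-L1-w45b-stub-4's D3-1 `TowerNestB₅` (✓
`…NatTowerNestDefs`, sig 286e872a33123e29: an in-carrier point step followed by a Δ-round inside the fresh plane — two blow-ups, every new `T` a closure) and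
his `ReachTowerBQuintPrime`; the prefix-level hypothesis is res-L1-w45b-idea-1's blob⁵ reach `PrefixReachBQuintPrime` (SPEC K6-loc v9 c31d2f5695bff7e1 §P5:
`PrefixReachBQuadPrime` with the initial-stage lettered clause over `ReachTowerBQuintPrime`) UNFOLDED (the def lives in a workfile), guarded by
`IsClosedImmersion ι` as S-T56′.  HONEST STATUS: idea-1 v9 notes that the 39th's inclusion #21 ⊆ P5 needs NO new closedness slot (`ND.NDInvCLNP` carries
`IsClosed T ∧ IsLocallyNoetherian F` itself); this file is BANKED for a future «DefTower⁵ ⊆ P5»-type inclusion and for any A⁵ customer needing «end `T`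
closed, end `F` locally Noetherian».  Bookkeeping only, no mathematics.  OURS; NOT a statement of any manuscript; AI-written, weaker than expert review.
No `sorry`; standard axioms; DEF-FREE.  `--supports stmt-ResolutionOfSingularities-20148 --as helper`.
-/

set_option linter.dupNamespace false -- mandated namespace `Summit.<Summit>.<Problem>` of this single-conjunct summit

noncomputable section

open CategoryTheory CategoryTheory.Limits AlgebraicGeometry TopologicalSpace Topology IsLocalRing
open Literature.AlgebraicGeometry.Resolution
open AlgebraicGeometry.Scheme.IdealSheafData
open Summit.ResolutionOfSingularities.ResolutionOfSingularities.Theses.EquisingularLift.Split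
open Summit.ResolutionOfSingularities.ResolutionOfSingularities.Cruxes.EquisingularLift.StrataSplit

namespace Summit.ResolutionOfSingularities.ResolutionOfSingularities.Cruxes.EquisingularLiftNat.Sections

/-- The NEST step preserves the motive «`T` closed ∧ ambient locally Noetherian» (two blow-ups; the new `T` is a closure). [OURS · bookkeeping] -/
theorem towerNestB₅_closedLN (F₁₀ : Scheme.{0}) :
    TowerNestB₅ F₁₀ (fun G _ T _ _ _ _ => IsClosed T ∧ IsLocallyNoetherian G) := by
  intro G G' G'' γ T E Es Ns K y υ₂ hy K' E' hE' Es' Ns' Z hZ υ₃ K'' E'' Es'' Ns'' hR _ _ hυ₂ _ _ _ _ _ _ _ _ _ _ _ hυ₃ _ _ _ _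
  haveI := hR.2
  haveI : IsLocallyNoetherian G' := isLocallyNoetherian_of_isBlowup hυ₂
  exact ⟨isClosed_closure, isLocallyNoetherian_of_isBlowup hυ₃⟩

/-- **Tower half over prefix⁵ (S-T56″):** from a locally Noetherian `F₂`, every `ReachTowerBQuintPrime`-reachable `(F', β, T')` has `T'` closed and `F'`
locally Noetherian (✓ p651608's motive + the NEST case). [OURS · bookkeeping] -/
theorem isClosed_and_isLocallyNoetherian_of_reachTowerBQuintPrime (F₁ F₂ : Scheme.{0}) (υ : F₂ ⟶ F₁) (x : F₁) (T₂ : Set F₂) (Ls₂ : List (Set F₂))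
    (F' : Scheme.{0}) (β : F' ⟶ F₂) (T' : Set F') (hF₂ : IsLocallyNoetherian F₂)
    (h : ReachTowerBQuintPrime F₁ F₂ υ x T₂ Ls₂ F' β T') : IsClosed T' ∧ IsLocallyNoetherian F' := by
  obtain ⟨W, K₂, F₉, β₉, T₉, Z₉, K₉, S₉, Ps₉, Ms₉, b₉, hZ₉, F₁₀, υ', Es₁₀, Ns₁₀, γ', E', Es', Ns', K', -, -, -, -, -, hIC, -, -, -, -, hυ', -, -, hcl, -⟩ := h
  have hF₉ : IsLocallyNoetherian F₉ := by
    refine hIC (fun G _ _ _ _ _ _ _ _ => IsLocallyNoetherian G) hF₂ ?_ ?_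
    · intro G₁ G₂ β T Z K S Ps Ms b y υ₁ hy Ps' Ms' hR _ _ _ hυ₁ _ _
      haveI : IsLocallyNoetherian G₁ := hR
      exact isLocallyNoetherian_of_isBlowup hυ₁
    · intro G₁ G₂ β T Z K S Ps Ms y υ₁ hy Ps' Ms' hR _ _ _ hυ₁ _ _
      haveI : IsLocallyNoetherian G₁ := hR
      exact isLocallyNoetherian_of_isBlowup hυ₁
  haveI := hF₉
  have hF₁₀ : IsLocallyNoetherian F₁₀ := isLocallyNoetherian_of_isBlowup hυ'
  obtain ⟨h1, h2, h3⟩ := towerSteps_closedLN F₉ F₁₀ υ' Z₉ hZ₉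
  exact hcl (fun G _ T _ _ _ _ => IsClosed T ∧ IsLocallyNoetherian G) ⟨isClosed_closure, hF₁₀⟩ h1 h2 h3 (towerNestB₅_closedLN F₁₀)


/-- **S-T56″ (guarded: `ι` a closed immersion): THE A⁵ PREFIX REACH DELIVERS A CLOSED `T` ON A LOCALLY NOETHERIAN `F`.**  Hypothesis = the body of
res-L1-w45b-idea-1's `PrefixReachBQuintPrime k n H ι F ρ T` (SPEC K6-loc v9 §P5) UNFOLDED; proof = ✓ p651608's motive with the lettered case over
`ReachTowerBQuintPrime`. [OURS · bookkeeping] -/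
theorem isClosed_and_isLocallyNoetherian_of_prefixReachBQuintPrime (k : Type) [Field k] [IsAlgClosed k] (n : ℕ) (H : AlgebraicGeometry.Scheme.{0})
    (ι : H ⟶ (Literature.AlgebraicGeometry.Motives.projectiveSpace n k).left) [AlgebraicGeometry.IsClosedImmersion ι] (F : AlgebraicGeometry.Scheme.{0})
    (ρ : F ⟶ (Literature.AlgebraicGeometry.Motives.projectiveSpace n k).left) (T : Set F)
    (h : (∀ Q : (∀ F₁ : AlgebraicGeometry.Scheme.{0}, (F₁ ⟶ (Literature.AlgebraicGeometry.Motives.projectiveSpace n k).left) → Set F₁ →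
      Prop), Q (Literature.AlgebraicGeometry.Motives.projectiveSpace n k).left (CategoryTheory.CategoryStruct.id (Literature.AlgebraicGeometry.Motives.projectiveSpace n k).left) (Set.range ι)
      →
      (∀ (F₁ F₂ : AlgebraicGeometry.Scheme.{0}) (ρ : F₁ ⟶ (Literature.AlgebraicGeometry.Motives.projectiveSpace n k).left) (T₁ : Set F₁) (x : ↥(AlgebraicGeometry.Scheme.IdealSheafData.vanishingIdeal (⟨closure T₁, isClosed_closure⟩ : TopologicalSpace.Closeds F₁)).subscheme) (υ : F₂ ⟶ F₁) (hx : IsClosed ({((AlgebraicGeometry.Scheme.IdealSheafData.vanishingIdeal (⟨closure T₁, isClosed_closure⟩ : TopologicalSpace.Closeds F₁)).subschemeι x : F₁)} : Set F₁)), Q F₁ ρ T₁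
      →
      ¬ IsRegularLocalRing ((AlgebraicGeometry.Scheme.IdealSheafData.vanishingIdeal (⟨closure T₁, isClosed_closure⟩ : TopologicalSpace.Closeds F₁)).subscheme.presheaf.stalk x)
      →
      IsRegularLocalRing (F₁.presheaf.stalk ((AlgebraicGeometry.Scheme.IdealSheafData.vanishingIdeal (⟨closure T₁, isClosed_closure⟩ : TopologicalSpace.Closeds F₁)).subschemeι x))
      →
      Literature.AlgebraicGeometry.Resolution.IsBlowup υ (AlgebraicGeometry.Scheme.IdealSheafData.vanishingIdeal (⟨{((AlgebraicGeometry.Scheme.IdealSheafData.vanishingIdeal (⟨closure T₁, isClosed_closure⟩ : TopologicalSpace.Closeds F₁)).subschemeι x : F₁)}, hx⟩ : TopologicalSpace.Closeds F₁))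
      →
      Q F₂ (CategoryTheory.CategoryStruct.comp υ ρ) (closure (υ ⁻¹' (T₁ \ {((AlgebraicGeometry.Scheme.IdealSheafData.vanishingIdeal (⟨closure T₁, isClosed_closure⟩ : TopologicalSpace.Closeds F₁)).subschemeι x : F₁)})))
      ∧
      (∀ (F₉ : AlgebraicGeometry.Scheme.{0}) (β : F₉ ⟶ F₂) (T₉ : Set F₉), ReachTowerBTriplePrime F₁ F₂ υ ((AlgebraicGeometry.Scheme.IdealSheafData.vanishingIdeal (⟨closure T₁, isClosed_closure⟩ : TopologicalSpace.Closeds F₁)).subschemeι x) (closure (υ ⁻¹' (T₁ \ {((AlgebraicGeometry.Scheme.IdealSheafData.vanishingIdeal (⟨closure T₁, isClosed_closure⟩ : TopologicalSpace.Closeds F₁)).subschemeι x : F₁)}))) F₉ β T₉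
      → Q F₉ (CategoryTheory.CategoryStruct.comp (CategoryTheory.CategoryStruct.comp β υ) ρ) T₉))  →
      (∀ (F₂ : AlgebraicGeometry.Scheme.{0}) (x₀ : ↥(AlgebraicGeometry.Scheme.IdealSheafData.vanishingIdeal (⟨closure (Set.range ι), isClosed_closure⟩ : TopologicalSpace.Closeds (Literature.AlgebraicGeometry.Motives.projectiveSpace n k).left)).subscheme) (υ : F₂ ⟶ (Literature.AlgebraicGeometry.Motives.projectiveSpace n k).left) (hx₀ : IsClosed ({((AlgebraicGeometry.Scheme.IdealSheafData.vanishingIdeal (⟨closure (Set.range ι), isClosed_closure⟩ : TopologicalSpace.Closeds (Literature.AlgebraicGeometry.Motives.projectiveSpace n k).left)).subschemeι x₀ : (Literature.AlgebraicGeometry.Motives.projectiveSpace n k).left)} : Set (Literature.AlgebraicGeometry.Motives.projectiveSpace n k).left)) (Ls₂ : List (Set F₂)), ¬ IsRegularLocalRing ((AlgebraicGeometry.Scheme.IdealSheafData.vanishingIdeal (⟨closure (Set.range ι), isClosed_closure⟩ : TopologicalSpace.Closeds (Literature.AlgebraicGeometry.Motives.projectiveSpace n k).left)).subscheme.presheaf.stalk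 x₀)
      →
      IsRegularLocalRing (((Literature.AlgebraicGeometry.Motives.projectiveSpace n k).left).presheaf.stalk ((AlgebraicGeometry.Scheme.IdealSheafData.vanishingIdeal (⟨closure (Set.range ι), isClosed_closure⟩ : TopologicalSpace.Closeds (Literature.AlgebraicGeometry.Motives.projectiveSpace n k).left)).subschemeι x₀ : (Literature.AlgebraicGeometry.Motives.projectiveSpace n k).left))
      →
      Literature.AlgebraicGeometry.Resolution.IsBlowup υ (AlgebraicGeometry.Scheme.IdealSheafData.vanishingIdeal (⟨{((AlgebraicGeometry.Scheme.IdealSheafData.vanishingIdeal (⟨closure (Set.range ι), isClosed_closure⟩ : TopologicalSpace.Closeds (Literature.AlgebraicGeometry.Motives.projectiveSpace n k).left)).subschemeι x₀ : (Literature.AlgebraicGeometry.Motives.projectiveSpace n k).left)}, hx₀⟩ : TopologicalSpace.Closeds (Literature.AlgebraicGeometry.Motives.projectiveSpace n k).left))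
      → (letI := MvPolynomial.gradedAlgebra (σ := Fin (n + 1)) (R := k); ∀ L ∈ Ls₂, ∃ ℓ : MvPolynomial (Fin (n + 1)) k, ℓ.IsHomogeneous 1 ∧ ℓ ≠ 0 ∧
      ((AlgebraicGeometry.Scheme.IdealSheafData.vanishingIdeal (⟨closure (Set.range ι), isClosed_closure⟩ : TopologicalSpace.Closeds (Literature.AlgebraicGeometry.Motives.projectiveSpace n k).left)).subschemeι x₀ : (Literature.AlgebraicGeometry.Motives.projectiveSpace n k).left) ∈ {y : (Literature.AlgebraicGeometry.Motives.projectiveSpace n k).left | ℓ ∈ (y : ProjectiveSpectrum (MvPolynomial.homogeneousSubmodule (Fin (n + 1)) k)).asHomogeneousIdeal}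
      ∧
      ¬ (Set.range ι ⊆ {y : (Literature.AlgebraicGeometry.Motives.projectiveSpace n k).left | ℓ ∈ (y : ProjectiveSpectrum (MvPolynomial.homogeneousSubmodule (Fin (n + 1)) k)).asHomogeneousIdeal})
      ∧
      L = closure (υ ⁻¹' ({y : (Literature.AlgebraicGeometry.Motives.projectiveSpace n k).left | ℓ ∈ (y : ProjectiveSpectrum (MvPolynomial.homogeneousSubmodule (Fin (n + 1)) k)).asHomogeneousIdeal} \ {((AlgebraicGeometry.Scheme.IdealSheafData.vanishingIdeal (⟨closure (Set.range ι), isClosed_closure⟩ : TopologicalSpace.Closeds (Literature.AlgebraicGeometry.Motives.projectiveSpace n k).left)).subschemeι x₀ : (Literature.AlgebraicGeometry.Motives.projectiveSpace n k).left)})))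
      →
      ∀ (F₉ : AlgebraicGeometry.Scheme.{0}) (β : F₉ ⟶ F₂) (T₉ : Set F₉), ReachTowerBQuintPrime (Literature.AlgebraicGeometry.Motives.projectiveSpace n k).left F₂ υ ((AlgebraicGeometry.Scheme.IdealSheafData.vanishingIdeal (⟨closure (Set.range ι), isClosed_closure⟩ : TopologicalSpace.Closeds (Literature.AlgebraicGeometry.Motives.projectiveSpace n k).left)).subschemeι x₀ : (Literature.AlgebraicGeometry.Motives.projectiveSpace n k).left) (closure (υ ⁻¹' (Set.range ι \ {((AlgebraicGeometry.Scheme.IdealSheafData.vanishingIdeal (⟨closure (Set.range ι), isClosed_closure⟩ : TopologicalSpace.Closeds (Literature.AlgebraicGeometry.Motives.projectiveSpace n k).left)).subschemeι x₀ : (Literature.AlgebraicGeometry.Motives.projectiveSpace n k).left)}))) Ls₂ F₉ β T₉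
      → Q F₉ (CategoryTheory.CategoryStruct.comp β υ) T₉) → Q F ρ T)) :
    IsClosed T ∧ IsLocallyNoetherian F := by
  haveI hPLN : IsLocallyNoetherian (Literature.AlgebraicGeometry.Motives.projectiveSpace n k).left :=
    LocallyOfFiniteType.isLocallyNoetherian (Literature.AlgebraicGeometry.Motives.projectiveSpace n k).hom
  refine h (fun F₁ _ T₁ => IsClosed T₁ ∧ IsLocallyNoetherian F₁) ⟨ι.isClosedEmbedding.isClosed_range, hPLN⟩ ?_ ?_
  · -- point step at any stage, then B‴ towers
    intro F₁ F₂ ρ₁ T₁ x υ hx hQ _ _ hυ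
    haveI := hQ.2
    have hF₂ : IsLocallyNoetherian F₂ := isLocallyNoetherian_of_isBlowup hυ
    exact ⟨⟨isClosed_closure, hF₂⟩, fun F₉ β T₉ hR =>
      isClosed_and_isLocallyNoetherian_of_reachTowerBTriplePrime F₁ F₂ υ _ _ F₉ β T₉ hF₂ hR⟩
  · -- lettered A⁵ towers (with NEST) at the initial stage
    intro F₂ x₀ υ hx₀ Ls₂ _ _ hυ _ F₉ β T₉ hR
    have hF₂ : IsLocallyNoetherian F₂ := isLocallyNoetherian_of_isBlowup hυ
    exact isClosed_and_isLocallyNoetherian_of_reachTowerBQuintPrime _ F₂ υ _ _ Ls₂ F₉ β T₉ hF₂ hR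

end Summit.ResolutionOfSingularities.ResolutionOfSingularities.Cruxes.EquisingularLiftNat.Sections

end
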